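import Summits.AtomisticToContinuum.BoseEinsteinCondensation.Theorems.PuffFloor.Negative.LatticeCosine
import Literature.MathematicalPhysics.QuantumManyBody.PeriodicBoseGasMomentumSector
import HarnessLib

/-!
# Close-pair domination (stub S1 of line `coupling-slope-pocket`): the kinetic term is load-bearing
(negative-side lemma for crux `PuffFloor`, stmt-AtomisticToContinuum-11785; cycle 3, Targets)

Cycle-3 file of the refuter's negative-side chain for crux `PuffFloor` of route
`BECConjugateDomination` (cdisprove seat gen 3, 2026-08-16). TARGET: `stub_corePairDomination`
(`E_Ψ[#pairs at periodic distance ≤ R] ≤ C ⟨Ψ, (−∑Δ + ∑(c₀1_{[0,r₀)})^per) Ψ⟩`, Lee 2009 Thm 7).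
Companion of `CorePairDominationConstState.lean` (which shows the CORE term is load-bearing); built
on the lattice-cosine device of `LatticeCosine.lean`:

* `shellState` — the normalised smooth periodic Bose-symmetric two-body state
  `Ψ(x₀,x₁) ∝ g((c(x₀−x₁) − c₁)(c₂ − c(x₀−x₁)))`, `g = expNegInvGlue`, `c₁ = 3 − 32/L²`,
  `c₂ = 3 − 2π²/L²`, `L ≥ 8`: all its mass sits at periodic distance `∈ (1, 2)` from coincidence
  (`shellState_support`: zero periodised core energy for `r₀ = 1`, at least one counted pair for
  `R = 2`);
* `corePairDomination_false_without_kinetic : ¬ CorePairDominationWithoutKinetic` — S1 with the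
  kinetic energy DELETED from the right-hand side (core interaction only; else byte for byte) is
  FALSE at `(c₀, r₀, R) = (1, 1, 2)` (`1 ≤ C · 0`). Hence Lee's bound genuinely needs BOTH terms: the
  core pays for pairs inside `r₀` (`corePairDomination_false_without_core`), the kinetic energy for
  close pairs in the corona `r₀ < |y| ≤ R` (this file; Lee's two-body Neumann branch
  `E^Neu(2, Q_ℓ) ≥ E′ > 0`).

No Theses statement is asserted positively. All `[folklore]`.
-/

noncomputable section

namespace Summit.AtomisticToContinuum.BoseEinsteinCondensation.Theorems.PuffFloor.Negative

open Literature.MathematicalPhysics.QuantumManyBody.BoseGas MeasureTheory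
open scoped ENNReal NNReal BigOperators

variable {L : ℝ}

/-- The flat glue is bounded by one. [folklore] -/
theorem expNegInvGlue_le_one (x : ℝ) : expNegInvGlue x ≤ 1 := by
  unfold expNegInvGlue
  split_ifs with h
  · exact zero_le_one
  · exact Real.exp_le_one_iff.2 (neg_nonpos.2 (inv_nonneg.2 (le_of_lt (not_le.1 h))))

/-! ### The shell state -/

/-- The (unnormalised, real) shell amplitude `g((c(x₀−x₁) − c₁)(c₂ − c(x₀−x₁)))`. [folklore] -/
def shellAmp (L c₁ c₂ : ℝ) (X : Config 2) : ℝ :=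
  expNegInvGlue ((latticeCos L (X 0 - X 1) - c₁) * (c₂ - latticeCos L (X 0 - X 1)))

/-- Where the shell amplitude is non-zero, `c₁ < c(x₀ − x₁) < c₂` (given `c₁ < c₂`). [folklore] -/
theorem levels_of_shellAmp_ne_zero {c₁ c₂ : ℝ} (h12 : c₁ < c₂) {X : Config 2}
    (hX : shellAmp L c₁ c₂ X ≠ 0) :
    c₁ < latticeCos L (X 0 - X 1) ∧ latticeCos L (X 0 - X 1) < c₂ := by
  have hpos : 0 < (latticeCos L (X 0 - X 1) - c₁) * (c₂ - latticeCos L (X 0 - X 1)) := by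
    by_contra h
    exact hX (expNegInvGlue.zero_of_nonpos (not_lt.1 h))
  rcases lt_or_ge c₁ (latticeCos L (X 0 - X 1)) with h1 | h1
  · refine ⟨h1, ?_⟩
    by_contra h2
    have : (latticeCos L (X 0 - X 1) - c₁) * (c₂ - latticeCos L (X 0 - X 1)) ≤ 0 :=
      mul_nonpos_of_nonneg_of_nonpos (by linarith) (by linarith [not_lt.1 h2])
    linarith
  · exfalso
    have : (latticeCos L (X 0 - X 1) - c₁) * (c₂ - latticeCos L (X 0 - X 1)) ≤ 0 :=
      mul_nonpos_of_nonpos_of_nonneg (by linarith) (by linarith)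
    linarith

/-- The shell amplitude is `C¹` (indeed smooth). [folklore] -/
theorem contDiff_shellAmp_real (L c₁ c₂ : ℝ) : ContDiff ℝ 1 (shellAmp L c₁ c₂) := by
  have hc : ContDiff ℝ 1 (fun X : Config 2 => latticeCos L (X 0 - X 1)) :=
    (contDiff_latticeCos L (n := 1)).comp ((contDiff_apply ℝ Space 0).sub (contDiff_apply ℝ Space 1))
  unfold shellAmp
  exact (expNegInvGlue.contDiff (n := 1)).comp ((hc.sub contDiff_const).mul (contDiff_const.sub hc))

/-- The complexified shell amplitude is `C¹`. [folklore] -/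
theorem contDiff_shellAmp (L c₁ c₂ : ℝ) :
    ContDiff ℝ 1 (fun X : Config 2 => (shellAmp L c₁ c₂ X : ℂ)) :=
  Complex.ofRealCLM.contDiff.comp (contDiff_shellAmp_real L c₁ c₂)

/-- The shell amplitude is `Lℤ³`-periodic in each particle. [folklore] -/
theorem shellAmp_periodic (hL : L ≠ 0) (c₁ c₂ : ℝ) (X : Config 2) (i : Fin 2) (a : Fin 3) :
    shellAmp L c₁ c₂ (X + Pi.single i (EuclideanSpace.single a L)) = shellAmp L c₁ c₂ X := by
  unfold shellAmp
  have : latticeCos L ((X + Pi.single i (EuclideanSpace.single a L) : Config 2) 0 -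
      (X + Pi.single i (EuclideanSpace.single a L) : Config 2) 1) = latticeCos L (X 0 - X 1) := by
    fin_cases i
    · simp only [Pi.add_apply, Fin.zero_eta, Pi.single_eq_same, Fin.isValue, ne_eq, one_ne_zero,
        not_false_eq_true, Pi.single_eq_of_ne, add_zero]
      rw [show X 0 + EuclideanSpace.single a L - X 1 = (X 0 - X 1) + EuclideanSpace.single a L by abel,
        latticeCos_add_single hL]
    · simp only [Pi.add_apply, Fin.mk_one, Fin.isValue, ne_eq, zero_ne_one, not_false_eq_true,
        Pi.single_eq_of_ne, add_zero, Pi.single_eq_same]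
      rw [show X 0 - (X 1 + EuclideanSpace.single a L) = (X 0 - X 1) - EuclideanSpace.single a L by abel,
        latticeCos_sub_single hL]
  rw [this]

/-- The shell amplitude is Bose-symmetric (`c` is even). [folklore] -/
theorem shellAmp_symm (c₁ c₂ : ℝ) (σ : Equiv.Perm (Fin 2)) (X : Config 2) :
    shellAmp L c₁ c₂ (X ∘ σ) = shellAmp L c₁ c₂ X := by
  unfold shellAmp
  have : latticeCos L ((X ∘ σ) 0 - (X ∘ σ) 1) = latticeCos L (X 0 - X 1) := by
    simp only [Function.comp_apply]
    by_cases h0 : σ 0 = 0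
    · have h1 : σ 1 = 1 := by
        refine Fin.eq_one_of_ne_zero _ fun h => ?_
        exact zero_ne_one (σ.injective (h0.trans h.symm))
      rw [h0, h1]
    · have h0' : σ 0 = 1 := Fin.eq_one_of_ne_zero _ h0
      have h1 : σ 1 = 0 := by
        by_contra h
        exact zero_ne_one (σ.injective (h0'.trans (Fin.eq_one_of_ne_zero _ h).symm))
      rw [h0', h1, ← latticeCos_neg L (X 1 - X 0), neg_sub]
  rw [this]

/-- A witness point in the open cell where the shell amplitude is non-zero, for the levels
`c₁ = 3 − 32/L²`, `c₂ = 3 − 2π²/L²` and `L ≥ 8`: `x₁ = (L/2,L/2,L/2)`, `x₀ = x₁ + s e₀` with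
`cos(2πs/L) = 1 − 26/L²`. [folklore] -/
theorem exists_shellAmp_ne_zero (hL : 8 ≤ L) :
    ∃ X₀ : Config 2, (∀ i a, X₀ i a ∈ Set.Ioo 0 L) ∧
      shellAmp L (3 - 32 / L ^ 2) (3 - 2 * Real.pi ^ 2 / L ^ 2) X₀ ≠ 0 := by
  have hL0 : 0 < L := by linarith
  have hL2 : (64 : ℝ) ≤ L ^ 2 := by nlinarith
  set u : ℝ := 1 - 26 / L ^ 2 with hu
  have h26 : 26 / L ^ 2 < 2 := by
    rw [div_lt_iff₀ (by positivity)]; linarith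
  have h26' : (0 : ℝ) ≤ 26 / L ^ 2 := by positivity
  have hu1 : -1 < u := by rw [hu]; linarith
  have hu2 : u ≤ 1 := by rw [hu]; linarith
  set s : ℝ := L / (2 * Real.pi) * Real.arccos u with hs
  have hs0 : 0 ≤ s := mul_nonneg (by positivity) (Real.arccos_nonneg u)
  have hsL : s < L / 2 := by
    have h := Real.arccos_lt_pi.2 hu1
    have : L / (2 * Real.pi) * Real.arccos u < L / (2 * Real.pi) * Real.pi :=
      mul_lt_mul_of_pos_left h (by positivity)
    calc s = L / (2 * Real.pi) * Real.arccos u := hs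
      _ < L / (2 * Real.pi) * Real.pi := this
      _ = L / 2 := by field_simp
  have hcos : Real.cos (2 * Real.pi * s / L) = u := by
    have : 2 * Real.pi * s / L = Real.arccos u := by
      rw [hs]; field_simp
    rw [this, Real.cos_arccos hu1.le hu2]
  set ctr : Space := EuclideanSpace.single 0 (L / 2) + EuclideanSpace.single 1 (L / 2) +
    EuclideanSpace.single 2 (L / 2) with hctr_def
  have hctr : ∀ a : Fin 3, ctr a = L / 2 := by
    intro a
    fin_cases a <;> simp [hctr_def]
  refine ⟨fun i => if i = 0 then ctr + EuclideanSpace.single 0 s else ctr, fun i a => ?_, ?_⟩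
  · fin_cases i
    · simp only [Fin.zero_eta, Fin.isValue, ↓reduceIte]
      rw [PiLp.add_apply, hctr, PiLp.single_apply]
      split_ifs <;> constructor <;> linarith
    · simp only [Fin.mk_one, Fin.isValue, one_ne_zero, ↓reduceIte]
      rw [hctr]; constructor <;> linarith
  · have hdiff : (fun i : Fin 2 => if i = 0 then ctr + EuclideanSpace.single 0 s else ctr) 0 -
        (fun i : Fin 2 => if i = 0 then ctr + EuclideanSpace.single 0 s else ctr) 1 =
        EuclideanSpace.single 0 s := by
      simp only [Fin.isValue, ↓reduceIte, one_ne_zero]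
      abel
    have hc : latticeCos L (EuclideanSpace.single (0 : Fin 3) s) = 3 - 26 / L ^ 2 := by
      rw [latticeCos, Fin.sum_univ_three]
      simp only [PiLp.single_apply, Fin.isValue, ↓reduceIte, one_ne_zero, Fin.reduceEq,
        mul_zero, zero_div, Real.cos_zero]
      rw [hcos, hu]; ring
    unfold shellAmp
    rw [hdiff, hc]
    refine (expNegInvGlue.pos_of_pos ?_).ne'
    have hπ : Real.pi ^ 2 < 13 := by nlinarith [Real.pi_lt_d2, Real.pi_pos]
    have h1 : (0 : ℝ) < 3 - 26 / L ^ 2 - (3 - 32 / L ^ 2) := by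
      rw [show (3 : ℝ) - 26 / L ^ 2 - (3 - 32 / L ^ 2) = 6 / L ^ 2 by ring]; positivity
    have h2 : (0 : ℝ) < 3 - 2 * Real.pi ^ 2 / L ^ 2 - (3 - 26 / L ^ 2) := by
      rw [show (3 : ℝ) - 2 * Real.pi ^ 2 / L ^ 2 - (3 - 26 / L ^ 2) = (26 - 2 * Real.pi ^ 2) / L ^ 2 by ring]
      exact div_pos (by linarith) (by positivity)
    exact mul_pos h1 h2

/-- **The shell state** on a torus of side `L ≥ 8`: the normalised smooth periodic Bose-symmetric
two-body state `Ψ ∝ g((c(x₀−x₁) − c₁)(c₂ − c(x₀−x₁)))` with `c₁ = 3 − 32/L²`, `c₂ = 3 − 2π²/L²`; its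
mass sits at periodic distance `∈ (1, 2)` from coincidence. [folklore] -/
def shellState (hL : 8 ≤ L) : PeriodicTrialState 2 L :=
  PeriodicTrialState.ofFun
    (fun X => (shellAmp L (3 - 32 / L ^ 2) (3 - 2 * Real.pi ^ 2 / L ^ 2) X : ℂ))
    (contDiff_shellAmp L _ _)
    (fun X i a => by rw [shellAmp_periodic (by linarith : L ≠ 0)])
    (fun σ X => by rw [shellAmp_symm])
    (by
      obtain ⟨X₀, hX₀, hne⟩ := exists_shellAmp_ne_zero hL
      exact (lintegral_cellN_pos (contDiff_shellAmp L _ _).continuous hX₀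
        (by exact_mod_cast hne)).ne')
    (by
      have hb : ∀ X : Config 2,
          (‖(shellAmp L (3 - 32 / L ^ 2) (3 - 2 * Real.pi ^ 2 / L ^ 2) X : ℂ)‖₊ : ℝ≥0∞) ^ 2 ≤ 1 := by
        intro X
        have h0 : 0 ≤ shellAmp L (3 - 32 / L ^ 2) (3 - 2 * Real.pi ^ 2 / L ^ 2) X :=
          expNegInvGlue.nonneg _
        have h1 : shellAmp L (3 - 32 / L ^ 2) (3 - 2 * Real.pi ^ 2 / L ^ 2) X ≤ 1 :=
          expNegInvGlue_le_one _
        have h2 : (‖(shellAmp L (3 - 32 / L ^ 2) (3 - 2 * Real.pi ^ 2 / L ^ 2) X : ℂ)‖₊ : ℝ≥0∞) ≤ 1 := by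
          rw [← ENNReal.coe_one, ENNReal.coe_le_coe, ← NNReal.coe_le_coe, coe_nnnorm,
            Complex.norm_real, Real.norm_of_nonneg h0, NNReal.coe_one]
          exact h1
        calc (‖(shellAmp L (3 - 32 / L ^ 2) (3 - 2 * Real.pi ^ 2 / L ^ 2) X : ℂ)‖₊ : ℝ≥0∞) ^ 2
            ≤ 1 ^ 2 := by gcongr
          _ = 1 := one_pow 2
      have hle : (∫⁻ X in cellN 2 L,
          (‖(shellAmp L (3 - 32 / L ^ 2) (3 - 2 * Real.pi ^ 2 / L ^ 2) X : ℂ)‖₊ : ℝ≥0∞) ^ 2) ≤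
          ∫⁻ _X in cellN 2 L, (1 : ℝ≥0∞) := lintegral_mono fun X => hb X
      rw [setLIntegral_const, one_mul, volume_cellN] at hle
      exact ne_top_of_le_ne_top (ENNReal.pow_ne_top (ENNReal.pow_ne_top ENNReal.ofReal_ne_top)) hle)

/-- The shell state is a constant multiple of the shell amplitude. [folklore] -/
theorem shellState_apply (hL : 8 ≤ L) (X : Config 2) : ∃ κ : ℂ, (shellState hL).ψ X =
    κ * (shellAmp L (3 - 32 / L ^ 2) (3 - 2 * Real.pi ^ 2 / L ^ 2) X : ℂ) :=
  ⟨_, PeriodicTrialState.ofFun_apply _ _ _ _ _ _ X⟩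

/-- On the support of the shell state: no core energy (`r₀ = 1`) and at least one counted pair
(`R = 2`). [folklore] -/
theorem shellState_support (hL : 8 ≤ L) {X : Config 2} (hX : (shellState hL).ψ X ≠ 0) :
    periodizedPotential (Set.indicator (Set.Iio 1) (fun _ : ℝ => ENNReal.ofReal 1)) L (X 0 - X 1) = 0 ∧
      1 ≤ periodizedPotential (Set.indicator (Set.Iic 2) (fun _ : ℝ => (1 : ℝ≥0∞))) L (X 0 - X 1) := by
  have hL0 : 0 < L := by linarith
  obtain ⟨κ, hκ⟩ := shellState_apply hL X
  have hamp : shellAmp L (3 - 32 / L ^ 2) (3 - 2 * Real.pi ^ 2 / L ^ 2) X ≠ 0 := by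
    intro h
    rw [hκ, h, Complex.ofReal_zero, mul_zero] at hX
    exact hX rfl
  have h12 : 3 - 32 / L ^ 2 < 3 - 2 * Real.pi ^ 2 / L ^ 2 := by
    have hπ : Real.pi ^ 2 < 13 := by nlinarith [Real.pi_lt_d2, Real.pi_pos]
    have : 2 * Real.pi ^ 2 / L ^ 2 < 32 / L ^ 2 := div_lt_div_of_pos_right (by linarith) (by positivity)
    linarith
  obtain ⟨hlo, hhi⟩ := levels_of_shellAmp_ne_zero h12 hamp
  constructor
  · refine periodizedPotential_core_eq_zero hL0 (r₀ := 1) (by linarith) _ ?_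
    simpa using hhi
  · refine one_le_periodizedPotential_count hL0 (R := 2) (by norm_num) ?_
    have : (3 : ℝ) - 8 * 2 ^ 2 / L ^ 2 = 3 - 32 / L ^ 2 := by norm_num
    rw [this]; exact hlo

/-! ### S1 without the kinetic term is false -/

/-- `stub_corePairDomination` with the KINETIC ENERGY DELETED from the right-hand side (only the
interaction energy of the core `c₀ 1_{[0,r₀)}` remains); everything else byte for byte. -/
def CorePairDominationWithoutKinetic : Prop :=
  ∀ c₀ r₀ R : ℝ, 0 < c₀ → 0 < r₀ → 0 < R →
    ∃ C L₀ : ℝ, 0 ≤ C ∧ 0 < L₀ ∧ ∀ N : ℕ, ∀ L : ℝ, L₀ ≤ L → ∀ Ψ : PeriodicTrialState N L,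
      (∫⁻ X in cellN N L,
          periodicInteraction (Set.indicator (Set.Iic R) (fun _ : ℝ => (1 : ℝ≥0∞))) L X *
            (‖Ψ.ψ X‖₊ : ℝ≥0∞) ^ 2) ≤
        ENNReal.ofReal C *
          ∫⁻ X in cellN N L,
            periodicInteraction (Set.indicator (Set.Iio r₀) (fun _ : ℝ => ENNReal.ofReal c₀)) L X *
              (‖Ψ.ψ X‖₊ : ℝ≥0∞) ^ 2

/-- Two particles: a single pair term. [folklore] -/
theorem periodicInteraction_two' (w : ℝ → ℝ≥0∞) (L : ℝ) (X : Config 2) :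
    periodicInteraction w L X = periodizedPotential w L (X 0 - X 1) := by
  have h0 : (Finset.univ.filter fun j : Fin 2 => (0 : Fin 2) < j) = {1} := by decide
  have h1 : (Finset.univ.filter fun j : Fin 2 => (1 : Fin 2) < j) = ∅ := by decide
  rw [periodicInteraction, Fin.sum_univ_two, h0, h1, Finset.sum_singleton, Finset.sum_empty, add_zero]

/-- **The kinetic term is load-bearing in S1.** With the kinetic energy deleted, the close-pair
domination fails at `(c₀, r₀, R) = (1, 1, 2)`: on any torus of side `L ≥ max L₀ 8` the shell state
has zero core interaction and one counted close pair (`1 ≤ C · 0` is false). [folklore] -/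
theorem corePairDomination_false_without_kinetic : ¬ CorePairDominationWithoutKinetic := by
  intro h
  obtain ⟨C, L₀, hC, hL₀, h⟩ := h 1 1 2 one_pos one_pos two_pos
  set L : ℝ := max L₀ 8 with hLdef
  have hL8 : 8 ≤ L := le_max_right _ _
  have key := h 2 L (le_max_left _ _) (shellState hL8)
  -- the right-hand side vanishes pointwise
  have hR : (∫⁻ X in cellN 2 L,
      periodicInteraction (Set.indicator (Set.Iio 1) (fun _ : ℝ => ENNReal.ofReal 1)) L X *
        (‖(shellState hL8).ψ X‖₊ : ℝ≥0∞) ^ 2) = 0 := by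
    have hzero : (fun X : Config 2 =>
        periodicInteraction (Set.indicator (Set.Iio 1) (fun _ : ℝ => ENNReal.ofReal 1)) L X *
          (‖(shellState hL8).ψ X‖₊ : ℝ≥0∞) ^ 2) = fun _ => 0 := by
      funext X
      by_cases hX : (shellState hL8).ψ X = 0
      · simp [hX]
      · rw [periodicInteraction_two', (shellState_support hL8 hX).1, zero_mul]
    rw [hzero, lintegral_zero]
  -- the left-hand side is at least the norm, `= 1`
  have hLhs : (1 : ℝ≥0∞) ≤ ∫⁻ X in cellN 2 L,
      periodicInteraction (Set.indicator (Set.Iic 2) (fun _ : ℝ => (1 : ℝ≥0∞))) L X *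
        (‖(shellState hL8).ψ X‖₊ : ℝ≥0∞) ^ 2 := by
    calc (1 : ℝ≥0∞) = ∫⁻ X in cellN 2 L, (‖(shellState hL8).ψ X‖₊ : ℝ≥0∞) ^ 2 :=
          (shellState hL8).norm_eq.symm
      _ ≤ _ := by
          refine lintegral_mono fun X => ?_
          by_cases hX : (shellState hL8).ψ X = 0
          · simp [hX]
          · calc (‖(shellState hL8).ψ X‖₊ : ℝ≥0∞) ^ 2
                = 1 * (‖(shellState hL8).ψ X‖₊ : ℝ≥0∞) ^ 2 := (one_mul _).symm
              _ ≤ _ := by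
                  refine mul_le_mul' ?_ le_rfl
                  rw [periodicInteraction_two']
                  exact (shellState_support hL8 hX).2
  rw [hR, mul_zero] at key
  exact absurd (hLhs.trans key) (by simp)

end Summit.AtomisticToContinuum.BoseEinsteinCondensation.Theorems.PuffFloor.Negative

end
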